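import Literature.Geometry.Lorentzian.ScalarCurvatureIntegrable
import HarnessLib

/-!
# The weight `(1 + ‖coord‖)^{-s}`, `s > 3`, is integrable on a one-ended asymptotically flat
# 3-manifold

The uniform control of the scalar curvatures of Schoen–Yau's metrics `ds²_t = ds² + t Ric`
(`RicciVariationScalarGlobal.lean`: `|R_t − R| ≤ |t| K (1 + ‖coord‖)⁻⁴`) dominates the difference
quotients `(R_t − R)/t` by multiples of the weight `W = (1 + ‖coord‖)⁻⁴`, and the smallness of
`R_t` in `L^{3/2}`, `L^{6/5}`, `L¹` needed for Lemmas 3.2–3.3 along the family and for the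
differentiation (3.27)–(3.30) of the mass integral (Comm. Math. Phys. 65 (1979), pp. 72–74) comes
down to the integrability of `W^p = (1 + ‖coord‖)^{−4p}`, `4p > 3`. This file proves:

* `AFEnd.measurable_coord` — the coordinate function of the end (the chart on the end, `0` off it)
  is measurable (continuous on the open end, constant off it);
* `AFEnd.integrable_one_add_norm_coord_rpow_neg` — for `s > 3`, `x ↦ (1 + ‖coord x‖)^{-s}` is
  integrable for the Riemannian measure of data whose only end is asymptotically flat
  (`h − δ = O₂(r^{−α})`, `α > 0`): it is bounded by `1` on a compact core (finite measure) and, read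
  in the chart of the end (`setLIntegral_far`, density `√det h_{ij} ≤ 7`,
  `exists_radius_sqrt_det_hCoeff_le`), by `7 (1 + ‖z‖)^{-s}` on the far region (Mathlib's
  `integrable_one_add_norm`, `s > 3 = dim`).

All results are proved; no definitions, no named facts.

## References

* R. Schoen, S.-T. Yau, Comm. Math. Phys. 65 (1979) 45–76, (3.3), (3.27)–(3.29) (pp. 64, 73).
-/

noncomputable section

open Set Function Filter Metric MeasureTheory Measure TopologicalSpace Manifold Bundle
open scoped Topology Manifold ContDiff ENNReal

namespace Literature.Geometry.Lorentzian

namespace AFEnd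

variable {X : Type} [TopologicalSpace X] [ChartedSpace E3 X] [IsManifold (𝓡 3) ∞ X]
  (e : AFEnd X) (D : InitialDataSet (𝓡 3) X)

omit [IsManifold (𝓡 3) ∞ X] in
/-- Off the end, `coord` is the junk value `0`. [folklore] -/
private theorem coord_of_not_mem₆ {q : X} (hq : q ∉ e.U) : e.coord q = 0 := by
  classical
  exact dif_neg hq

omit [IsManifold (𝓡 3) ∞ X] in
/-- **The coordinate function of the end is measurable** (continuous on the open end, `0` off
it). [folklore] -/
theorem measurable_coord [MeasurableSpace X] [BorelSpace X] : Measurable e.coord := by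
  classical
  have hcont : ContinuousOn e.coord e.U := fun q hq ↦
    (e.contMDiffAt_coord hq).continuousAt.continuousWithinAt
  have hpw : (e.U : Set X).piecewise e.coord (fun _ ↦ (0 : E3)) = e.coord := by
    funext q
    by_cases hq : q ∈ (e.U : Set X)
    · rw [piecewise_eq_of_mem _ _ _ hq]
    · rw [piecewise_eq_of_notMem _ _ _ hq, e.coord_of_not_mem₆ hq]
  rw [← hpw]
  exact hcont.measurable_piecewise continuousOn_const e.U.2.measurableSet

variable [T2Space X] [LocallyCompactSpace X] [MeasurableSpace X] [BorelSpace X]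

/-- **`(1 + ‖coord‖)^{-s} ∈ L¹(dV_h)` for `s > 3`** on a one-ended manifold whose end is
asymptotically flat (`h − δ = O₂(r^{−α})`, `α > 0`): bounded by `1` on a compact core, and by
`7 (1 + ‖z‖)^{-s}` in the chart of the end (`setLIntegral_far`, `√det h_{ij} ≤ 7`), where
`(1 + ‖z‖)^{-s}` is integrable on `ℝ³` (`integrable_one_add_norm`). This is the integrability of
the weight dominating `R_t − R` and its difference quotients along `ds² + t Ric`
(Schoen–Yau 1979, (3.3), (3.28)–(3.29)). [cite: SchoenYauPMT1979, (3.28)–(3.29) (p. 73)] -/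
theorem integrable_one_add_norm_coord_rpow_neg [D.metric.HasLeviCivita] {α : ℝ} (hα : 0 < α)
    (hAF : e.IsMetricAsymptoticallyFlat D α) (hsole : e.IsSoleEnd) {s : ℝ} (hs : 3 < s) :
    Integrable (fun x ↦ (1 + ‖e.coord x‖) ^ (-s)) (riemannianMeasure D.h) := by
  set μ : Measure X := riemannianMeasure D.h with hμ
  set f : X → ℝ := fun x ↦ (1 + ‖e.coord x‖) ^ (-s) with hf
  haveI : IsFiniteMeasureOnCompacts μ :=
    ⟨fun K hK ↦ riemannianVolume_lt_top_of_isCompact_holds D.h le_rfl hK⟩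
  have hfm : AEStronglyMeasurable f μ := by
    have hm : Measurable f :=
      (((measurable_const.add e.measurable_coord.norm)).pow_const (-s))
    exact hm.aestronglyMeasurable
  have hf0 : ∀ x, 0 ≤ f x := fun x ↦ Real.rpow_nonneg (by positivity) _
  have hf1 : ∀ x, f x ≤ 1 := fun x ↦ by
    have h1 : (1 : ℝ) ≤ 1 + ‖e.coord x‖ := by
      have := norm_nonneg (e.coord x)
      linarith
    exact Real.rpow_le_one_of_one_le_of_nonpos h1 (by linarith)
  -- the radius with `√det ≤ 7`
  obtain ⟨R₃, hdens⟩ := e.exists_radius_sqrt_det_hCoeff_le D hα hAF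
  set R₂ : ℝ := max R₃ e.R with hR₂
  have hRR₂ : e.R ≤ R₂ := le_max_right _ _
  -- the compact piece
  obtain ⟨Kc, hKc, hcover⟩ := hsole.exists_isCompact_cover R₂
  have hint_K : IntegrableOn f Kc μ := by
    refine Integrable.mono' (g := fun _ ↦ (1 : ℝ)) ?_ hfm.restrict (ae_of_all _ fun x ↦ ?_)
    · exact integrableOn_const (hKc.measure_lt_top.ne)
    · rw [Real.norm_of_nonneg (hf0 x)]
      exact hf1 x
  -- the far region
  have hint_far : IntegrableOn f (e.far R₂) μ := by
    refine ⟨hfm.restrict, ?_⟩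
    rw [hasFiniteIntegral_iff_enorm]
    have hen : ∀ p, ‖f p‖ₑ = ENNReal.ofReal (f p) := fun p ↦ Real.enorm_eq_ofReal (hf0 p)
    simp only [hen]
    rw [e.setLIntegral_far D (fun p ↦ ENNReal.ofReal (f p)) hRR₂]
    have hg : IntegrableOn (fun z : E3 ↦ 7 * (1 + ‖z‖) ^ (-s)) {z | R₂ < ‖z‖} volume := by
      refine ((integrable_one_add_norm ?_).const_mul 7).integrableOn
      simpa using hs
    refine lt_of_le_of_lt (setLIntegral_mono'
      (isOpen_lt continuous_const continuous_norm).measurableSet (fun z hz ↦ ?_))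
      (hasFiniteIntegral_iff_enorm.1 hg.2)
    have hzR : e.R < ‖z‖ := hRR₂.trans_lt hz
    have hzR₃ : R₃ ≤ ‖z‖ := (le_max_left _ _).trans hz.le
    have hd := hdens z hzR₃
    have hcoord : e.coord (e.dataChartExt z) = z := by
      rw [e.dataChartExt_of_lt hzR, e.coord_dataChart]
    have hfz : f (e.dataChartExt z) = (1 + ‖z‖) ^ (-s) := by
      simp only [hf, hcoord]
    have hnn : 0 ≤ (1 + ‖z‖) ^ (-s) := Real.rpow_nonneg (by positivity) _
    have h7 : 0 ≤ 7 * (1 + ‖z‖) ^ (-s) := by positivity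
    rw [hfz]
    calc ENNReal.ofReal ((1 + ‖z‖) ^ (-s)) * ENNReal.ofReal (Real.sqrt (Matrix.of fun i j ↦
          hCoeff e D z (EuclideanSpace.single i 1) (EuclideanSpace.single j 1)).det)
        ≤ ENNReal.ofReal ((1 + ‖z‖) ^ (-s)) * ENNReal.ofReal 7 :=
          mul_le_mul' le_rfl (ENNReal.ofReal_le_ofReal hd)
      _ = ‖7 * (1 + ‖z‖) ^ (-s)‖ₑ := by
          rw [← ENNReal.ofReal_mul hnn, Real.enorm_eq_ofReal h7, mul_comm]
  exact integrableOn_univ.1 ((hint_K.union hint_far).mono_set fun p _ ↦ hcover p)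

/-- **Along the family: `(1 + ‖coord‖)^{-s} ∈ L¹(dV_t)`** whenever `dV_t ≤ C dV_h` (the measure
comparison of `RicciVariationUniformConstants.lean`). [folklore] -/
theorem integrable_one_add_norm_coord_rpow_neg_of_le [D.metric.HasLeviCivita] {α : ℝ} (hα : 0 < α)
    (hAF : e.IsMetricAsymptoticallyFlat D α) (hsole : e.IsSoleEnd) {s : ℝ} (hs : 3 < s)
    {D₂ : InitialDataSet (𝓡 3) X} {C : ℝ}
    (hμ : riemannianMeasure D₂.h ≤ ENNReal.ofReal C • riemannianMeasure D.h) :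
    Integrable (fun x ↦ (1 + ‖e.coord x‖) ^ (-s)) (riemannianMeasure D₂.h) :=
  ((e.integrable_one_add_norm_coord_rpow_neg D hα hAF hsole hs).smul_measure
    ENNReal.ofReal_ne_top).mono_measure hμ

end AFEnd

end Literature.Geometry.Lorentzian

end
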